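import Summits.HodgeConjecture.HodgeConjecture.Theorems.R90S6HeckeCoeffIndepOfIso       -- ★ W7-a.4 `coeff_toVector_comp_eq_of_memLaw`
import Summits.HodgeConjecture.HodgeConjecture.Theorems.R90S6IndexSeparatesU3Inert     -- ★ W8-c′ `mem_orbit_of_ncard_orbit_eq_inert` (the `hsep` payer at an inert place, N = 3)
import Literature.NumberTheory.Automorphic.HyperspecialUnitaryCartanAdicCompletion     -- ★ `unramifiedLocalConjDatum_adicCompletion` (the datum exists at every non-split unramified place)
import HarnessLib

/-!
# R90 · S6 «Ch. 14.1–14.5 stable trace formula» — WAVE 9-A card (A.2): «eG-INDEPENDENCE» AT AN INERT UNRAMIFIED PLACE, `N = 3`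
# (`Theorems/R90S6HeckeCoeffIndepInert.lean`)

Cell `hodgecm-mathlib`, crux H413 (`stmt-HodgeConjecture-24833`), route of record `HCCMUnconditional`; programme R90-TF, section S6 (base `R90-C14`), seat
R90-C14-p07 (g0); S6 dealer R90-C14-plan (g2) DEAL W9-A (R90 bus l.5391 ∕ l.5467, reminder 2026-09-05T00:01:35Z); AUDIT BOX S6#W9-A SHEET CLEAN (l.5385).
Statement VERBATIM from the typist's sheet `R90/R90-C14-typ1/g2/S6_wave9A_targets.v1.db09522d8f01f282.lean` :138–:152 (namespace `…R90.S6`, the sheet's `.Wave9A`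
dropped).  Lane `--kind proof --supports stmt-HodgeConjecture-24833 --as helper`; ONE public theorem; no definition, no instance, no notation, no named fact, no `sorry`;
imports = ★ `Theorems/R90S6HeckeCoeffIndepOfIso` (W7-a.4) + ★ `Theorems/R90S6IndexSeparatesU3Inert` (W8-c′) + ★ `HyperspecialUnitaryCartanAdicCompletion` + HarnessLib
(no Lines import).

THE MATHEMATICS.  At an inert place `w ∣ v` of a quadratic extension `E ∕ F` of number fields (`c ∈ Gal(E∕F)`, `c ≠ 1`, `c • w = w`, `v` unramified in `E`) put
`U_w = U(σ_w, J₀)(E_w)` (`σ_w = galAdicCompletionMap c hw`, `J₀ = antidiag(1,1,1)`) and `K₀ = unitaryInt σ_w J₀` (hyperspecial).  For any group `Gv` with a subgroup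
`Kv` and any two isomorphisms `e e' : Gv ≃* U_w` obeying the K-law `e g ∈ K₀ ↔ g ∈ Kv` (both), every `T ∈ ℋ(U_w, K₀)` is read as the SAME function
`g ↦ (T [K₀])((e g) K₀)` on `Gv` — because `θ := e.symm.trans e'` is an automorphism of `U_w` preserving `K₀`, the index `#(K₀ u K₀ ∕ K₀)` separates the
`K₀`-double cosets of `U_w` (★ W8-c′ `mem_orbit_of_ncard_orbit_eq_inert`, from the Cartan shells `K₀ tᵐ K₀` and their sphere counts `(q_v³+1)·q_v^m·q_v^{3(m−1)}`),
so `θ` fixes every double coset and `T [K₀]` is bi-`K₀`-invariant (★ W7-a.4 `coeff_toVector_comp_eq_of_memLaw`).  The unramified datum `(ϖ, hd)` needed by W8-c′ exists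
at every such place (★ `unramifiedLocalConjDatum_adicCompletion`), so NO `ϖ ∕ hd` binder appears in the statement.  This is the inert-place form the E1.3.9 ∕ E1.4.4.5a
assemblies consume through its CM dress (A.3): the ∀-bound transport `eG` of the Hecke ∕ twisted-transfer FL sockets reduces to ONE framed transport.
HONEST LABEL: helper theorem, count-neutral until (A.3) ∕ E1.3.9 consume it; proves no printed statement by itself.  HC_CM is proved only modulo the 7 printed citations
(2 remaining named inputs: hLiu418 = stmt-HodgeConjecture-24832, h413 = stmt-HodgeConjecture-24833) until rung 0 closes.

## References
* [CartierCorvallis1979] P. Cartier, *Representations of 𝔭-adic groups: a survey*, PSPM 33.1 (1979), §IV.1 (spherical Hecke algebra as bi-`K`-invariant functions).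
* [BruhatTits1972] F. Bruhat, J. Tits, *Groupes réductifs sur un corps local I*, Publ. Math. IHÉS 41 (1972), (4.4.3)–(4.4.4) (Cartan shells and their indices).
* [Tits1979] J. Tits, *Reductive groups over local fields*, PSPM 33.1 (1979), §3.3.3 (hyperspecial subgroups).
-/
set_option autoImplicit false
-- the mandated namespace repeats the single-problem summit's segment (`HodgeConjecture.HodgeConjecture`)
set_option linter.dupNamespace false

noncomputable section

open scoped Valued WithZero Matrix MatrixGroups

open MulAction MonoidAlgebra
open Literature.NumberTheory.Automorphic Literature.NumberTheory.Automorphic.HermitianLattice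
  Literature.NumberTheory.Automorphic.UnitaryLatticeTree

namespace Summit.HodgeConjecture.HodgeConjecture.R90.S6

section InertPlace

open _root_.NumberField _root_.IsDedekindDomain Literature.NumberTheory.Automorphic.UnitaryGroup

variable {k : Type*} [CommRing k]
variable {F E : Type} [Field F] [NumberField F] [Field E] [NumberField E] [Algebra F E] [Algebra.IsQuadraticExtension F E]
  (c : E ≃ₐ[F] E) (v : HeightOneSpectrum (𝓞 F))

/-- **W9-A.2 «eG-independence» at an inert unramified place, `N = 3`** (`U_w = U(σ_w, J₀)(E_w)`, `K₀ = unitaryInt`): any two isomorphisms `e e' : Gv ≃* U_w` carrying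
`Kv` onto `K₀` read every `T ∈ ℋ(U_w, K₀)` as the same function `g ↦ (T [K₀])((e g) K₀)` on `Gv`.  Proof: obtain `⟨ϖ, hd⟩ :=` ★ `unramifiedLocalConjDatum_adicCompletion
c hc v w hw hv`, then ★ W7-a.4 `coeff_toVector_comp_eq_of_memLaw` with `hsep :=` ★ W8-c′ `mem_orbit_of_ncard_orbit_eq_inert c v hc hv w hw hd`.  (Sheet
`S6_wave9A_targets.v1.db09522d8f01f282.lean` :138 verbatim.) [cite: CartierCorvallis1979, §IV.1] [cite: BruhatTits1972, (4.4.3), (4.4.4)] [cite: Tits1979, §3.3.3] -/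
theorem coeff_toVector_comp_eq_of_memLaw_inert (hc : c ≠ 1) (hv : Algebra.IsUnramifiedIn (𝓞 E) v.asIdeal) (w : UnitaryGroup.PlacesOver E v)
    (hw : c • w.1 = w.1) {Gv : Type*} [Group Gv] (Kv : Subgroup Gv)
    (e e' : Gv ≃* ↥(unitaryGroupOfForm (galAdicCompletionMap (L := E) c hw) ((StdForm.antidiagonal 3).over (w.1.adicCompletion E))))
    (he : ∀ g, e g ∈ unitaryInt (galAdicCompletionMap (L := E) c hw) ((StdForm.antidiagonal 3).over (w.1.adicCompletion E)) ↔ g ∈ Kv)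
    (he' : ∀ g, e' g ∈ unitaryInt (galAdicCompletionMap (L := E) c hw) ((StdForm.antidiagonal 3).over (w.1.adicCompletion E)) ↔ g ∈ Kv)
    (T : heckeAlgebra k ↥(unitaryGroupOfForm (galAdicCompletionMap (L := E) c hw) ((StdForm.antidiagonal 3).over (w.1.adicCompletion E)))
      (unitaryInt (galAdicCompletionMap (L := E) c hw) ((StdForm.antidiagonal 3).over (w.1.adicCompletion E)))) :
    (fun g : Gv => (heckeAlgebra.toVector (unitaryInt (galAdicCompletionMap (L := E) c hw) ((StdForm.antidiagonal 3).over (w.1.adicCompletion E))) T).coeff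
        ((e' g : ↥(unitaryGroupOfForm (galAdicCompletionMap (L := E) c hw) ((StdForm.antidiagonal 3).over (w.1.adicCompletion E)))) :
          ↥(unitaryGroupOfForm (galAdicCompletionMap (L := E) c hw) ((StdForm.antidiagonal 3).over (w.1.adicCompletion E))) ⧸
            unitaryInt (galAdicCompletionMap (L := E) c hw) ((StdForm.antidiagonal 3).over (w.1.adicCompletion E)))) =
      fun g : Gv => (heckeAlgebra.toVector (unitaryInt (galAdicCompletionMap (L := E) c hw) ((StdForm.antidiagonal 3).over (w.1.adicCompletion E))) T).coeff
        ((e g : ↥(unitaryGroupOfForm (galAdicCompletionMap (L := E) c hw) ((StdForm.antidiagonal 3).over (w.1.adicCompletion E)))) :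
          ↥(unitaryGroupOfForm (galAdicCompletionMap (L := E) c hw) ((StdForm.antidiagonal 3).over (w.1.adicCompletion E))) ⧸
            unitaryInt (galAdicCompletionMap (L := E) c hw) ((StdForm.antidiagonal 3).over (w.1.adicCompletion E))) := by
  obtain ⟨ϖ, hd⟩ := unramifiedLocalConjDatum_adicCompletion c hc v w hw hv
  exact coeff_toVector_comp_eq_of_memLaw Kv
    (unitaryInt (galAdicCompletionMap (L := E) c hw) ((StdForm.antidiagonal 3).over (w.1.adicCompletion E)))
    (fun u u' h => mem_orbit_of_ncard_orbit_eq_inert c v hc hv w hw hd u u' h) e e' he he' T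

end InertPlace

end Summit.HodgeConjecture.HodgeConjecture.R90.S6

end
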